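import Summits.QuantumFields.YangMills.Theorems.DiagonalMirrorRPRWilsonDiagonalModelLiftedOp

/-!
# Crux `DiagonalMirrorRPR` (stmt-QuantumFields-10604), line `sign-twisted-diagonal-trace`, construction F1_diag
# (director-ym O4 WORD 3 (A)), operator layer: EVERY section of the lifted kernel is square integrable (uniform bound)

Helper for the crux `DiagonalMirrorRPR` of `YangMills` (routes `IsotropyFromPowerCounting`, `MirrorModularBoosts`,
`PencilRigidity`; item stmt-QuantumFields-10604), attached `--supports … --as helper`; it closes nothing by itself.
Continuation of `…WilsonDiagonalModelLiftedOp` (the lifted operator `𝔄`, its eigenbasis, `Σ κ² = ∫𝔞²`).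

* `exists_tsum_pairMass_le` — `Σ_{k′} pairMass k k′ ≤ E · ∫ ψ_k(w(ΘY))² dY`;
* ★ `lintegral_natKernel_section_sq_le` — `∫ 𝔞((k,X), ·)² dν ≤ C · ∫ ψ_k(w(ΘY))² dY` for EVERY `(k, X)` (uniform in `X`);
* `memLp_natKernel_section` — every section `𝔞(a, ·)` is in `L²(ν)`, `ν = liftMeasure S G` (not only a.e., as the generic
  `L²`-kernel theory gives): this is what the pointwise/Parseval form of the trace formulas
  (`(𝔄 b_i)(a) = ⟪𝔞(a,·), b_i⟫`, `Σ_i ⟪𝔞(a,·), b_i⟫² = ‖𝔞(a,·)‖²` for every `a`) uses (S4, OWED).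

HONEST FRAMING: a construction helper; no `def wilsonDiagonalModel`; nothing about D_old ⟨10604⟩, the RP crux of the FOLD
restate, or the summit is proved; the Yang–Mills mass gap is NOT proved here or anywhere in the tree.
-/

set_option autoImplicit false

noncomputable section

open MeasureTheory
open Literature.MathematicalPhysics.QuantumLattice Literature.MathematicalPhysics.QuantumFieldTheory
open Summit.QuantumFields.YangMills.Cruxes.DiagonalMirrorRPR.ParityBridgeColdTraces

namespace Summit.QuantumFields.YangMills.Cruxes.DiagonalMirrorRPR.SignTwistedDiagonalTrace.WilsonDiagonal

/-! ## §20 Sections of the lifted kernel: `∫ 𝔞((k,X), ·)² dν ≤ C · E · ∫ ψ_k(w(ΘY))² dY` for EVERY `(k, X)` -/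

section Sections

variable {S : ℕ} [NeZero S] {G : Type} [Group G] {Nc : ℕ} (ρ : G →* Matrix (Fin Nc) (Fin Nc) ℂ)
variable [TopologicalSpace G] [IsTopologicalGroup G] [CompactSpace G] [MeasurableSpace G] [BorelSpace G]
  [SecondCountableTopology G]

/-- The single feature sum of the dominating sequence: `Σ_{k′} pairMass k k′ ≤ E · ∫ ψ_k(w(ΘY))² dY`. -/
theorem exists_tsum_pairMass_le (hρ : Continuous ρ) {β : ℝ} (hβ : 0 ≤ β) :
    ∃ E : ℝ, 0 < E ∧ ∀ k : ℕ, ∑' k' : ℕ, pairMass (S := S) ρ β k k' ≤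
      ENNReal.ofReal E * ∫⁻ Y, ENNReal.ofReal (natFeature (p := featDim S Nc) β k (bondVec ρ (thetaHalf Y)) ^ 2) ∂(halfHaar S G) := by
  obtain ⟨E, hE, hsum⟩ := exists_tsum_natFeature_sq_le (S := S) ρ hρ hβ
  refine ⟨E, hE, fun k => ?_⟩
  have hmk : ∀ k' : ℕ, Measurable fun Y : HalfCfg S S G =>
      ENNReal.ofReal (natFeature (p := featDim S Nc) β k (bondVec ρ (thetaHalf Y)) ^ 2 *
        natFeature (p := featDim S Nc) β k' (bondVec ρ Y) ^ 2) := fun k' =>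
    ENNReal.measurable_ofReal.comp
      ((((continuous_natFeature_bondVec ρ hρ β k).comp continuous_thetaHalf).pow 2).mul
        ((continuous_natFeature_bondVec ρ hρ β k').pow 2)).measurable
  have hmu : Measurable fun Y : HalfCfg S S G =>
      ENNReal.ofReal (natFeature (p := featDim S Nc) β k (bondVec ρ (thetaHalf Y)) ^ 2) :=
    ENNReal.measurable_ofReal.comp (((continuous_natFeature_bondVec ρ hρ β k).comp continuous_thetaHalf).pow 2).measurable
  unfold pairMass
  rw [← lintegral_tsum fun k' => (hmk k').aemeasurable, ← lintegral_const_mul _ hmu]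
  refine lintegral_mono fun Y => ?_
  have hB := (hsum Y).1
  have hBt : ∑' k' : ℕ, ENNReal.ofReal (natFeature (p := featDim S Nc) β k' (bondVec ρ Y) ^ 2) =
      ENNReal.ofReal (Real.exp (β * ∑ j, bondVec ρ Y j ^ 2)) := by
    rw [← hB.tsum_eq, ENNReal.ofReal_tsum_of_nonneg (fun k' => sq_nonneg _) hB.summable]
  simp only [ENNReal.ofReal_mul (sq_nonneg _), ENNReal.tsum_mul_left, hBt]
  rw [mul_comm]
  exact mul_le_mul_left (ENNReal.ofReal_le_ofReal (hsum Y).2) _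

/-- ★ **Every section of the lifted kernel is square integrable**, with the explicit bound
`∫ 𝔞((k, X), ·)² dν ≤ C · E · ∫ ψ_k(w(ΘY))² dY` (uniform in `X`; `ν = liftMeasure S G`).  In particular the sections
`𝔞(a, ·) ∈ L²(ν)` for EVERY `a` (not only a.e.), which is what the pointwise (Parseval) form of the trace formulas uses. -/
theorem lintegral_natKernel_section_sq_le (hρ : Continuous ρ) {β : ℝ} (hβ : 0 ≤ β) :
    ∃ C : ℝ, 0 < C ∧ ∀ (k : ℕ) (X : HalfCfg S S G),
      ∫⁻ b, ENNReal.ofReal (natKernel ρ β (k, X) b ^ 2) ∂(liftMeasure S G) ≤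
        ENNReal.ofReal C * ∫⁻ Y, ENNReal.ofReal (natFeature (p := featDim S Nc) β k (bondVec ρ (thetaHalf Y)) ^ 2) ∂(halfHaar S G) := by
  haveI : IsProbabilityMeasure (halfHaar S G) := by unfold halfHaar; infer_instance
  haveI : SFinite (liftMeasure S G) := by unfold liftMeasure; infer_instance
  obtain ⟨C, hC, hdom⟩ := exists_ofReal_natKernel_sq_le (S := S) ρ hρ β
  obtain ⟨E, hE, hE1⟩ := exists_tsum_pairMass_le (S := S) ρ hρ hβ
  refine ⟨C * E, mul_pos hC hE, fun k X => ?_⟩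
  have hsec : Measurable fun b : ℕ × HalfCfg S S G => ENNReal.ofReal (natKernel ρ β (k, X) b ^ 2) := by
    have h1 : Measurable fun b : ℕ × HalfCfg S S G => natKernel ρ β (k, X) b := by
      refine measurable_from_prod_countable_right fun k' => ?_
      exact ((continuous_natKernel ρ hρ β k k').comp (Continuous.prodMk_right X)).measurable
    exact ENNReal.measurable_ofReal.comp (h1.pow_const 2)
  rw [liftMeasure, lintegral_prod _ hsec.aemeasurable, lintegral_count]
  calc ∑' k', ∫⁻ X', ENNReal.ofReal (natKernel ρ β (k, X) (k', X') ^ 2) ∂(halfHaar S G)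
      ≤ ∑' k', ENNReal.ofReal C * pairMass (S := S) ρ β k k' := by
        refine ENNReal.tsum_le_tsum fun k' => ?_
        calc ∫⁻ X', ENNReal.ofReal (natKernel ρ β (k, X) (k', X') ^ 2) ∂(halfHaar S G)
            ≤ ∫⁻ _X', ENNReal.ofReal C * pairMass (S := S) ρ β k k' ∂(halfHaar S G) := lintegral_mono fun X' => hdom k k' X X'
          _ = ENNReal.ofReal C * pairMass (S := S) ρ β k k' := by rw [lintegral_const, measure_univ, mul_one]
    _ = ENNReal.ofReal C * ∑' k', pairMass (S := S) ρ β k k' := ENNReal.tsum_mul_left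
    _ ≤ ENNReal.ofReal C * (ENNReal.ofReal E * ∫⁻ Y, ENNReal.ofReal (natFeature (p := featDim S Nc) β k
          (bondVec ρ (thetaHalf Y)) ^ 2) ∂(halfHaar S G)) := mul_le_mul_right (hE1 k) _
    _ = ENNReal.ofReal (C * E) * ∫⁻ Y, ENNReal.ofReal (natFeature (p := featDim S Nc) β k
          (bondVec ρ (thetaHalf Y)) ^ 2) ∂(halfHaar S G) := by rw [ENNReal.ofReal_mul hC.le, mul_assoc]

/-- Every section of the lifted kernel is in `L²(ν)`. -/
theorem memLp_natKernel_section (hρ : Continuous ρ) {β : ℝ} (hβ : 0 ≤ β) (a : ℕ × HalfCfg S S G) :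
    MemLp (fun b => natKernel ρ β a b) 2 (liftMeasure S G) := by
  haveI : IsFiniteMeasure (halfHaar S G) := by unfold halfHaar; infer_instance
  obtain ⟨C, hC, hle⟩ := lintegral_natKernel_section_sq_le (S := S) ρ hρ hβ
  obtain ⟨k, X⟩ := a
  have h1 : Measurable fun b : ℕ × HalfCfg S S G => natKernel ρ β (k, X) b := by
    refine measurable_from_prod_countable_right fun k' => ?_
    exact ((continuous_natKernel ρ hρ β k k').comp (Continuous.prodMk_right X)).measurable
  rw [memLp_two_iff_integrable_sq h1.aestronglyMeasurable]
  refine ⟨(h1.pow_const 2).aestronglyMeasurable, ?_⟩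
  rw [hasFiniteIntegral_iff_ofReal (ae_of_all _ fun b => sq_nonneg _)]
  refine lt_of_le_of_lt (hle k X) (ENNReal.mul_lt_top ENNReal.ofReal_lt_top ?_)
  have hcont : Continuous fun Y : HalfCfg S S G => natFeature (p := featDim S Nc) β k (bondVec ρ (thetaHalf Y)) ^ 2 :=
    ((continuous_natFeature_bondVec ρ hρ β k).comp continuous_thetaHalf).pow 2
  rw [← ofReal_integral_eq_lintegral_ofReal (integrable_of_continuous_halfHaar hcont) (ae_of_all _ fun Y => sq_nonneg _)]
  exact ENNReal.ofReal_lt_top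

end Sections

end Summit.QuantumFields.YangMills.Cruxes.DiagonalMirrorRPR.SignTwistedDiagonalTrace.WilsonDiagonal

end
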